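import Summits.QuantumAdvantage.AdviceFreeQNC0.BlockAdditiveHalf
import HarnessLib

/-!
# Cell qa-qnc0 (rung F-Q1, route RingFrame, crux α, line `product`): FAR-SET BALANCE FOR
# BLOCK-ADDITIVE MAPS — `Sketch8b.BlockAdditiveFSB` PROVED, with τ'' = 0 (qn-p1 TARGET §20.8, ask P6e)

Final file of the prover's τ''-free proof (HOME/qa-qnc0-prover/PROVER-MEMO-gen4.md §2):

* `cpl` (bit complement) and `card_far_cls_cpl`: complementing all bits turns the block-additive map
  `G` into `G ∘ cpl`, preserves farness and sends class `s` to class `L + 2s`; with it the class-`(r+2)`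
  half `blockAdditive_far_cls_succ_succ_le` (`BlockAdditiveHalf.lean`) yields the class-`(r+1)` half
  `blockAdditive_far_cls_succ_le`;
* `blockAdditive_far_le`: **`#FAR_{13θ} ≤ 16423 · #(FAR_θ ∩ cls r)`** for `k ≥ 13` blocks of size
  `≥ 2`, block-local `G`, all `D`, `θ ≥ 0`, `r` — far-set balance with sandwich ratio `c = 13`,
  `κ' = 1/16423`, NO additive slack and ABSOLUTE `k₀ = 13` (the planner's statement has `− τ''·2^L`
  and `k₀ = k₀(τ, τ'')`);
* `blockAdditiveFSB` : `Sketch8b.BlockAdditiveFSB` VERBATIM (the `let Γ` of the statement is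
  `gammaBA G` by `rfl`), as a trivial corollary.

D-uniform, no degree hypothesis, no PLDAMS: the second unit test of the level-set method (TARGET
§20.7–20.9) is a kernel theorem.  WHAT THIS IS NOT: nothing on FSB/FW at general column degree — for
`k = 1` block the statement is false without a degree bound (TARGET §20.8) — nothing on α, no
separation claim.
-/

noncomputable section

namespace Summit.QuantumAdvantage.AdviceFreeQNC0

open Finset
open Literature.Computability.MetaComplexity Literature.Computability.MetaComplexity.Smolensky

namespace BlockAdditive

variable {L L' k : ℕ}

/-- Bit complement. -/
def cpl (u : Fin L → Bool) : Fin L → Bool := fun j => !u j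

/-- `cpl` is an involution. -/
theorem cpl_cpl (u : Fin L → Bool) : cpl (cpl u) = u := by
  funext j; unfold cpl; simp

/-- Weight of the complement. -/
theorem wt_cpl (u : Fin L → Bool) : wt (cpl u) + wt u = L := by
  unfold wt cpl
  have h := Finset.card_filter_add_card_filter_not (s := (univ : Finset (Fin L))) (p := fun j => u j = true)
  rw [Finset.card_univ, Fintype.card_fin] at h
  have e : (univ.filter fun j : Fin L => (!u j) = true) = univ.filter fun j : Fin L => ¬ u j = true :=
    Finset.filter_congr fun j _ => by cases u j <;> simp
  rw [e]
  omega

/-- The complemented summands are block-local. -/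
theorem blockLocal_cpl {blk : Fin L → Fin k} {G : Fin k → (Fin L → Bool) → (Fin L' → Bool) → Bool}
    (hG : BlockLocal blk G) : BlockLocal blk (fun i u => G i (cpl u)) := by
  intro i u u' h
  exact hG i (cpl u) (cpl u') fun j hj => by unfold cpl; rw [h j hj]

/-- `Γ_{G ∘ cpl} u = Γ_G (cpl u)`. -/
theorem gammaBA_cpl (G : Fin k → (Fin L → Bool) → (Fin L' → Bool) → Bool) (u : Fin L → Bool) :
    gammaBA (fun i u => G i (cpl u)) u = gammaBA G (cpl u) := rfl

/-- **Complement transport**: `#(FAR_θ(G ∘ cpl) ∩ cls s) = #(FAR_θ(G) ∩ cls (L + 2s))`. -/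
theorem card_far_cls_cpl (G : Fin k → (Fin L → Bool) → (Fin L' → Bool) → Bool) (D : ℕ) (θ : ℝ)
    (s : ℕ) :
    (far D (gammaBA (fun i u => G i (cpl u))) θ ∩ cls L s).card =
      (far D (gammaBA G) θ ∩ cls L (L + 2 * s)).card := by
  refine Finset.card_bij (fun u _ => cpl u) (fun u hu => ?_) (fun u _ u' _ h => ?_) (fun w hw => ?_)
  · rw [Finset.mem_inter] at hu ⊢
    obtain ⟨hf, hc⟩ := hu
    unfold far at hf ⊢
    unfold cls at hc ⊢
    simp only [Finset.mem_filter, Finset.mem_univ, true_and] at hf hc ⊢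
    refine ⟨by rw [← gammaBA_cpl G u]; exact hf, ?_⟩
    have h := wt_cpl u
    omega
  · have := congrArg cpl h
    rwa [cpl_cpl, cpl_cpl] at this
  · refine ⟨cpl w, ?_, cpl_cpl w⟩
    rw [Finset.mem_inter] at hw ⊢
    obtain ⟨hf, hc⟩ := hw
    unfold far at hf ⊢
    unfold cls at hc ⊢
    simp only [Finset.mem_filter, Finset.mem_univ, true_and] at hf hc ⊢
    refine ⟨by rw [gammaBA_cpl G (cpl w), cpl_cpl]; exact hf, ?_⟩
    have h := wt_cpl w
    omega

/-- **The class-`(r+1)` half** (from the class-`(r+2)` half by complementing all bits). -/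
theorem blockAdditive_far_cls_succ_le (blk : Fin L → Fin k)
    (G : Fin k → (Fin L → Bool) → (Fin L' → Bool) → Bool) (hG : BlockLocal blk G) (hk : 13 ≤ k)
    (hblk : ∀ i : Fin k, 2 ≤ (univ.filter fun j : Fin L => blk j = i).card)
    (D : ℕ) (θ : ℝ) (r : ℕ) :
    ((far D (gammaBA G) (13 * θ) ∩ cls L (r + 1)).card : ℝ) ≤
      8211 * ((far D (gammaBA G) θ ∩ cls L r).card : ℝ) := by
  have h := blockAdditive_far_cls_succ_succ_le blk (fun i u => G i (cpl u)) (blockLocal_cpl hG) hk hblk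
    D θ (2 * r + L)
  rw [card_far_cls_cpl, card_far_cls_cpl] at h
  have e1 : cls L (L + 2 * (2 * r + L + 2)) = cls L (r + 1) := by
    unfold cls; refine Finset.filter_congr fun u _ => ?_; omega
  have e2 : cls L (L + 2 * (2 * r + L)) = cls L r := by
    unfold cls; refine Finset.filter_congr fun u _ => ?_; omega
  rw [e1, e2] at h
  exact h

/-- **FAR-SET BALANCE FOR BLOCK-ADDITIVE MAPS, τ'' = 0**: for `k ≥ 13` blocks of size `≥ 2`,
block-local `G`, every `D`, every `θ ≥ 0` and every `r`,
`#FAR_{13θ} ≤ 16423 · #(FAR_θ ∩ cls r)`. -/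
theorem blockAdditive_far_le (blk : Fin L → Fin k)
    (G : Fin k → (Fin L → Bool) → (Fin L' → Bool) → Bool) (hG : BlockLocal blk G) (hk : 13 ≤ k)
    (hblk : ∀ i : Fin k, 2 ≤ (univ.filter fun j : Fin L => blk j = i).card)
    (D : ℕ) {θ : ℝ} (hθ : 0 ≤ θ) (r : ℕ) :
    ((far D (gammaBA G) (13 * θ)).card : ℝ) ≤ 16423 * ((far D (gammaBA G) θ ∩ cls L r).card : ℝ) := by
  have h1 := blockAdditive_far_cls_succ_le blk G hG hk hblk D θ r
  have h2 := blockAdditive_far_cls_succ_succ_le blk G hG hk hblk D θ r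
  -- the class-r part is inside FAR_θ ∩ cls r
  have h0 : (far D (gammaBA G) (13 * θ) ∩ cls L r).card ≤ (far D (gammaBA G) θ ∩ cls L r).card := by
    refine Finset.card_le_card (Finset.inter_subset_inter_right ?_)
    intro u hu
    unfold far at hu ⊢
    rw [Finset.mem_filter] at hu ⊢
    refine ⟨hu.1, le_trans ?_ hu.2⟩
    have : (0 : ℝ) ≤ (2 : ℝ) ^ L' := by positivity
    nlinarith
  -- split FAR by classes
  have hsplit : (far D (gammaBA G) (13 * θ)).card ≤
      (far D (gammaBA G) (13 * θ) ∩ cls L r).card + (far D (gammaBA G) (13 * θ) ∩ cls L (r + 1)).card +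
        (far D (gammaBA G) (13 * θ) ∩ cls L (r + 2)).card := by
    have hsub : far D (gammaBA G) (13 * θ) ⊆
        ((far D (gammaBA G) (13 * θ) ∩ cls L r) ∪ (far D (gammaBA G) (13 * θ) ∩ cls L (r + 1))) ∪
          (far D (gammaBA G) (13 * θ) ∩ cls L (r + 2)) := by
      intro u hu
      unfold cls
      rw [Finset.mem_union, Finset.mem_union, Finset.mem_inter, Finset.mem_inter, Finset.mem_inter,
        Finset.mem_filter, Finset.mem_filter, Finset.mem_filter]
      have h3 : wt u % 3 = r % 3 ∨ wt u % 3 = (r + 1) % 3 ∨ wt u % 3 = (r + 2) % 3 := by omega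
      rcases h3 with h | h | h
      · exact Or.inl (Or.inl ⟨hu, Finset.mem_univ _, h⟩)
      · exact Or.inl (Or.inr ⟨hu, Finset.mem_univ _, h⟩)
      · exact Or.inr ⟨hu, Finset.mem_univ _, h⟩
    exact (Finset.card_le_card hsub).trans
      ((Finset.card_union_le _ _).trans (Nat.add_le_add_right (Finset.card_union_le _ _) _))
  have hsplit' : ((far D (gammaBA G) (13 * θ)).card : ℝ) ≤
      ((far D (gammaBA G) (13 * θ) ∩ cls L r).card : ℝ) +
        ((far D (gammaBA G) (13 * θ) ∩ cls L (r + 1)).card : ℝ) +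
        ((far D (gammaBA G) (13 * θ) ∩ cls L (r + 2)).card : ℝ) := by exact_mod_cast hsplit
  have h0' : ((far D (gammaBA G) (13 * θ) ∩ cls L r).card : ℝ) ≤
      ((far D (gammaBA G) θ ∩ cls L r).card : ℝ) := by exact_mod_cast h0
  linarith

/-- **`Sketch8b.BlockAdditiveFSB` (qn-p1 TARGET §20.8, ask P6e), VERBATIM**: far-set balance for
block-additive maps `Γ u = 𝟙 ⊕ ⨁_i G_i(u|_{B_i})`, `k ≥ k₀` blocks of size `≥ 2`, arbitrary block-local
`G_i`, no degree hypothesis, no PLDAMS — with `c = 13`, `κ' = 1/16423`, `k₀ = 13` (the slack `τ''` is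
not needed: `blockAdditive_far_le`). -/
theorem blockAdditiveFSB :
    ∃ c : ℝ, 1 ≤ c ∧ ∃ κ' : ℝ, 0 < κ' ∧ ∀ τ τ'' : ℝ, 0 < τ → 0 < τ'' → ∃ k₀ : ℕ,
      ∀ L L' k : ℕ, k₀ ≤ k → ∀ blk : Fin L → Fin k,
        (∀ i : Fin k, 2 ≤ (univ.filter fun j : Fin L => blk j = i).card) →
        ∀ G : Fin k → (Fin L → Bool) → (Fin L' → Bool) → Bool,
          (∀ i u u', (∀ j, blk j = i → u j = u' j) → G i u = G i u') →
          ∀ D r : ℕ,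
            let Γ : (Fin L → Bool) → (Fin L' → Bool) → Bool :=
              fun u v => !(Nat.bodd (univ.filter fun i : Fin k => G i u v = true).card)
            κ' * ((far D Γ τ).card : ℝ) - τ'' * (2 : ℝ) ^ L ≤ ((far D Γ (τ / c) ∩ cls L r).card : ℝ) := by
  refine ⟨13, by norm_num, 1 / 16423, by norm_num, fun τ τ'' hτ hτ'' => ⟨13, ?_⟩⟩
  intro L L' k hk blk hblk G hG D r
  show 1 / 16423 * ((far D (gammaBA G) τ).card : ℝ) - τ'' * (2 : ℝ) ^ L ≤
    ((far D (gammaBA G) (τ / 13) ∩ cls L r).card : ℝ)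
  have h := blockAdditive_far_le blk G hG hk hblk D (θ := τ / 13) (by positivity) r
  have e : 13 * (τ / 13) = τ := by ring
  rw [e] at h
  have hpos : (0 : ℝ) ≤ τ'' * (2 : ℝ) ^ L := by positivity
  linarith

end BlockAdditive

end Summit.QuantumAdvantage.AdviceFreeQNC0

end
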